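import Literature.AlgebraicGeometry.Resolution.CoefficientIdealRestriction
import Literature.AlgebraicGeometry.Resolution.HypersurfaceRestriction
import Literature.AlgebraicGeometry.Resolution.RsopMonomialIdeals
import Literature.AlgebraicGeometry.Resolution.ResolutionGlue
import HarnessLib

/-!
# Centres inside a hypersurface: admissibility on `X` versus on `S = V(H)` (BGMW 2011, Lemma 3.9.4 (1))

Topic: `Literature/AlgebraicGeometry/Resolution`. Layer of the decomposition of the named facts
`BierstoneGrigorievMilmanWlodarczyk2011_marked` / `_canonical` (Bierstone–Grigoriev–Milman–
Włodarczyk, arXiv:1206.3090, Thm. 8.0.5). Clauses (1) and (3) of Lemma 3.9.4 — for a marked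
ideal `(X, 𝓘, E, μ)` of maximal order and a smooth hypersurface `S` having only simple normal
crossings with `E`:

  "(1) The restrictions `σ_{i|S_i} : S_i → S_{i-1}` of the morphisms `σ_i : X_i → X_{i-1}`
  define a multiple blow-up `(S_i)` of `𝒞(𝓘, μ)|_S`. … (3) Every multiple blow-up `(S_i)` of
  `𝒞(𝓘, μ)|_S` defines a multiple blow-up `(X_i)` of `(𝓘, μ)` with centers `C_i` contained in
  the strict transforms `S_i ⊂ X_i` of `S ⊂ X`" —

compare ADMISSIBILITY of a centre inside `S` for `(𝓘, μ)` on `X` (Def. 3.1.3 (1)–(2): inside the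
support, smooth, snc with `E`) with admissibility of the same centre for `𝒞(𝓘, μ)|_S` on `S`.
Given the support identity of clause (2) (`CoefficientIdealRestriction.lean`,
`CoefficientIdealRestrictionPersistence.lean`) and the restriction property (§4 Remark (3),
`HypersurfaceRestriction.lean`), what remains is bookkeeping between ideal sheaves on `X` and on
the closed subscheme `ι : S = V(H) → X`, PROVED here for the direction `X → S` (clause (1)):

* `le_map_subschemeι`, **`comap_map_subschemeι`** (`(ι_* C_S)|_S = C_S`),
  **`map_comap_subschemeι_of_le`** (`ι_*(C|_S) = C` when `H ⊆ C`), `coe_support_map_subschemeι`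
  (`supp ι_* C_S = ι(supp C_S)`), `isIso_lift_map_subschemeι` (`V(ι_* C_S) ≅ V(C_S)`),
  **`isRegular_subscheme_map_subschemeι_iff`**, **`isRegular_subscheme_comap_subschemeι_iff`**
  — smoothness [regularity] of the centre is the same on `X` and on `S`;
* `rsop_quotient_succAbove` — a minimal basis `u_0, …, u_n` of `𝔪_R` (`R` regular local) maps,
  omitting `u_{i₀}`, to a minimal basis of the maximal ideal of `R' = R/(u_{i₀})`, regular of
  embedding dimension `n` (Matsumura Thm. 14.2);
* **`HasSNCWith.comap_subschemeι_of_cons`** — if `C` has simple normal crossings with the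
  boundary `H :: E` on `X` (`S`, `E`, `C` simultaneously given by one regular system of
  parameters at each point: "`S` has only simple normal crossings with `E`") and `H ∉ E`, then
  `C|_S` has simple normal crossings with `E|_S` on `S`;
* **`MarkedIdeal.admissible_comap_subschemeι`** — Lemma 3.9.4 (1) for one blow-up: for an
  admissible centre `C ⊇ H` of `(𝓘, E, μ)` in this position and a marked ideal `𝒩` on `S` with
  boundary `E|_S` and `supp 𝒩 = ι⁻¹ supp(𝓘, μ)`, the centre `C|_S` is admissible for `𝒩`;
  `IsBlowup.isMultipleBlowup_transform_comap_subschemeι` — hence the induced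
  `πS : S' → S` is a (one-step) multiple blow-up of `𝒩` (`IsMultipleBlowup`).

The converse direction (clause (3): a centre `C_S` on `S` snc with `E|_S` gives `ι_* C_S` snc
with `H :: E` on `X`, by lifting a regular system of parameters of `𝒪_{S,x}` and exchanging the
equations of the divisors) is not in this file.

## Sources

* E. Bierstone, D. Grigoriev, P. Milman, J. Włodarczyk, arXiv:1206.3090 (arXiv numbering):
  Def. 3.1.3, Lemma 3.9.4 (1), (3) (p. 10), §4 Remark (3) (p. 11).
  [BierstoneGrigorievMilmanWlodarczyk2011]
* H. Matsumura, *Commutative Ring Theory* (1986), Thm. 14.2. [Matsumura1987]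
-/

noncomputable section

open CategoryTheory CategoryTheory.Limits AlgebraicGeometry TopologicalSpace IsLocalRing

namespace Literature.AlgebraicGeometry.Resolution

universe u

/-! ## Ideal sheaves on `X` and on the closed subscheme `S = V(H)` -/

section MapComap

variable {X : Scheme.{u}} (H : X.IdealSheafData)

/-- `H ⊆ ι_* C_S`: the ideal on `X` of a closed subscheme of `S = V(H)` contains `H`. [folklore] -/
theorem le_map_subschemeι (CS : H.subscheme.IdealSheafData) : H ≤ CS.map H.subschemeι := by
  conv_lhs => rw [← Scheme.IdealSheafData.ker_subschemeι H]
  exact Scheme.Hom.le_ker_comp _ _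

/-- **`(ι_* C_S)|_S = C_S`** for the closed immersion `ι : S = V(H) → X`. [folklore] -/
theorem comap_map_subschemeι (CS : H.subscheme.IdealSheafData) :
    (CS.map H.subschemeι).comap H.subschemeι = CS := by
  refine le_antisymm (Scheme.IdealSheafData.comap_map_le _ _) ?_
  -- check on the affine opens `ι⁻¹U`, `U ⊆ X` affine
  let V : X.affineOpens → H.subscheme.affineOpens := fun U =>
    ⟨H.subschemeι ⁻¹ᵁ (U : X.Opens), U.2.preimage H.subschemeι⟩
  have hcov : ⨆ U, (V U : H.subscheme.Opens) = ⊤ := by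
    refine top_le_iff.mp fun s _ => Opens.mem_iSup.mpr ?_
    obtain ⟨U, hU, hxU, -⟩ := exists_isAffineOpen_mem_and_subset (X := X) (x := H.subschemeι s)
      (U := ⊤) (Opens.mem_top _)
    exact ⟨⟨U, hU⟩, hxU⟩
  refine Scheme.IdealSheafData.le_of_iSup_eq_top V hcov fun U => ?_
  rw [ideal_comap_of_le H.subschemeι _ U (V U) le_rfl,
    Scheme.IdealSheafData.ideal_map_of_isAffineHom, ← Scheme.Hom.app_eq_appLE,
    Ideal.map_comap_of_surjective _ (H.subschemeι.app_surjective U U.2)]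

/-- **`ι_* (C|_S) = C`** when `H ⊆ C` (the centre lies in `S`). [folklore] -/
theorem map_comap_subschemeι_of_le {C : X.IdealSheafData} (hHC : H ≤ C) :
    (C.comap H.subschemeι).map H.subschemeι = C := by
  refine le_antisymm ?_ (Scheme.IdealSheafData.le_map_comap _ _)
  intro U
  rw [Scheme.IdealSheafData.ideal_map_of_isAffineHom,
    ideal_comap_of_le H.subschemeι _ U ⟨_, U.2.preimage H.subschemeι⟩ le_rfl,
    ← Scheme.Hom.app_eq_appLE,
    Ideal.comap_map_of_surjective _ (H.subschemeι.app_surjective U U.2), ← RingHom.ker_eq_comap_bot,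
    ← Scheme.Hom.ker_apply, Scheme.IdealSheafData.ker_subschemeι]
  exact sup_le le_rfl (hHC U)

/-- **The support of `ι_* C_S` is the image of the support of `C_S`.** [folklore] -/
theorem coe_support_map_subschemeι (CS : H.subscheme.IdealSheafData) :
    ((CS.map H.subschemeι).support : Set X) = H.subschemeι '' CS.support := by
  rw [Scheme.IdealSheafData.support_map, Closeds.coe_closure,
    (H.subschemeι.isClosedEmbedding.isClosedMap _ CS.support.isClosed).closure_eq]

/-- The kernel condition for lifting `V(C_S) → X` through `V(ι_* C_S) → X`. [folklore] -/
theorem ker_subschemeι_map_le (CS : H.subscheme.IdealSheafData) :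
    (CS.map H.subschemeι).subschemeι.ker ≤ (CS.subschemeι ≫ H.subschemeι).ker :=
  (Scheme.IdealSheafData.ker_subschemeι _).le.trans (le_of_eq rfl)

/-- **`V(ι_* C_S) ≅ V(C_S)`**: the closed subscheme of `X` defined by `ι_* C_S` is isomorphic
to the closed subscheme `V(C_S)` of `S` (two closed immersions into `X` with the same kernel).
[folklore] -/
theorem isIso_lift_map_subschemeι (CS : H.subscheme.IdealSheafData) :
    IsIso (IsClosedImmersion.lift (CS.map H.subschemeι).subschemeι (CS.subschemeι ≫ H.subschemeι)
      (ker_subschemeι_map_le H CS)) :=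
  IsClosedImmersion.isIso_of_ker_eq (CS.subschemeι ≫ H.subschemeι) (CS.map H.subschemeι).subschemeι
    _ (IsClosedImmersion.lift_fac _ _ _)
    (by rw [Scheme.Hom.ker_comp, Scheme.IdealSheafData.ker_subschemeι,
      Scheme.IdealSheafData.ker_subschemeι])

/-- **Regularity of the centre does not depend on whether it is viewed in `S` or in `X`**:
`V(ι_* C_S)` is regular iff `V(C_S)` is. [folklore] -/
theorem isRegular_subscheme_map_subschemeι_iff (CS : H.subscheme.IdealSheafData) :
    Scheme.IsRegular (CS.map H.subschemeι).subscheme ↔ Scheme.IsRegular CS.subscheme := by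
  haveI := isIso_lift_map_subschemeι H CS
  constructor
  · intro h
    exact Scheme.IsRegular.of_iso (inv (IsClosedImmersion.lift (CS.map H.subschemeι).subschemeι
      (CS.subschemeι ≫ H.subschemeι) (ker_subschemeι_map_le H CS))) h
  · intro h
    exact Scheme.IsRegular.of_iso (IsClosedImmersion.lift (CS.map H.subschemeι).subschemeι
      (CS.subschemeι ≫ H.subschemeι) (ker_subschemeι_map_le H CS)) h

/-- For a centre inside `S` (`H ⊆ C`): `V(C|_S)` is regular iff `V(C)` is. [folklore] -/
theorem isRegular_subscheme_comap_subschemeι_iff {C : X.IdealSheafData} (hHC : H ≤ C) :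
    Scheme.IsRegular (C.comap H.subschemeι).subscheme ↔ Scheme.IsRegular C.subscheme := by
  rw [← isRegular_subscheme_map_subschemeι_iff H, map_comap_subschemeι_of_le H hHC]

end MapComap

/-! ## Regular systems of parameters modulo one parameter -/

section RsopQuotient

variable {R R' : Type*} [CommRing R] [CommRing R'] [IsRegularLocalRing R] [IsLocalRing R']

/-- **A regular system of parameters modulo one of its members**: if `u_0, …, u_n` is a minimal
basis of the maximal ideal of the regular local ring `R` and `q : R → R'` is a surjection of local
rings with kernel `(u_{i₀})`, then `R'` is regular of embedding dimension `n` and the images of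
the `u_i`, `i ≠ i₀`, form a minimal basis of its maximal ideal (Matsumura Thm. 14.2).
[cite: Matsumura1987, Thm. 14.2] -/
theorem rsop_quotient_succAbove (q : R →+* R') (hq : Function.Surjective q) {n : ℕ}
    (hd : (maximalIdeal R).spanFinrank = n + 1) (u : Fin (n + 1) → R)
    (hu : Ideal.span (Set.range u) = maximalIdeal R) (i₀ : Fin (n + 1))
    (hker : RingHom.ker q = Ideal.span {u i₀}) :
    IsRegularLocalRing R' ∧ (maximalIdeal R').spanFinrank = n ∧
      Ideal.span (Set.range (q ∘ u ∘ i₀.succAbove)) = maximalIdeal R' := by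
  -- `u i₀ ∈ 𝔪 ∖ 𝔪²`
  have hz : IsRsopPart (fun _ : Fin 1 => u i₀) :=
    isRsopPart_comp_of_rsop hd u hu (fun _ => i₀) (fun a b _ => Subsingleton.elim a b)
  have hmem : u i₀ ∈ maximalIdeal R := hz.mem_maximalIdeal 0
  have hsq : u i₀ ∉ maximalIdeal R ^ 2 := hz.not_mem_sq 0
  -- `R' ≅ R/(u i₀)` is regular of embedding dimension `n`
  haveI : IsLocalRing (R ⧸ Ideal.span {u i₀}) :=
    isLocalRing_quotient (Ideal.span_singleton_ne_top hmem)
  haveI hreg := (IsRegularLocalRing.quotient_span_singleton hmem hsq).1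
  let e : (R ⧸ Ideal.span {u i₀}) ≃+* R' :=
    (Ideal.quotEquivOfEq hker.symm).trans (RingHom.quotientKerEquivOfSurjective hq)
  haveI hreg' : IsRegularLocalRing R' := IsRegularLocalRing.of_ringEquiv e
  have hfr : (maximalIdeal R').spanFinrank = n := by
    have h1 := spanFinrank_maximalIdeal_quotient_add_one hmem hsq
    rw [hd] at h1
    have h2 : ((maximalIdeal R').spanFinrank : WithBot ℕ∞) =
        (maximalIdeal (R ⧸ Ideal.span {u i₀})).spanFinrank := by
      rw [IsRegularLocalRing.spanFinrank_maximalIdeal, IsRegularLocalRing.spanFinrank_maximalIdeal,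
        ringKrullDim_eq_of_ringEquiv e]
    have h3 : (maximalIdeal R').spanFinrank = (maximalIdeal (R ⧸ Ideal.span {u i₀})).spanFinrank := by
      exact_mod_cast h2
    omega
  refine ⟨hreg', hfr, ?_⟩
  -- the images of the other parameters generate `𝔪_{R'}`
  have hq0 : q (u i₀) = 0 := by
    rw [← RingHom.mem_ker, hker]
    exact Ideal.mem_span_singleton_self _
  apply le_antisymm
  · rw [← map_maximalIdeal_of_surjective q hq, Ideal.span_le]
    rintro _ ⟨j, rfl⟩
    exact Ideal.mem_map_of_mem q (hu ▸ Ideal.subset_span ⟨i₀.succAbove j, rfl⟩)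
  · rw [← map_maximalIdeal_of_surjective q hq, ← hu, Ideal.map_span, Ideal.span_le]
    rintro _ ⟨_, ⟨i, rfl⟩, rfl⟩
    by_cases hi : i = i₀
    · rw [hi, hq0]
      exact zero_mem _
    · obtain ⟨j, rfl⟩ := Fin.exists_succAbove_eq hi
      exact Ideal.subset_span ⟨j, rfl⟩

end RsopQuotient

/-! ## Simple normal crossings on `X` and on the hypersurface `S` -/

section SNC

variable {X : Scheme.{u}} {H C : X.IdealSheafData} {E : List X.IdealSheafData}

/-- **BGMW Lemma 3.9.4 (1), the boundary condition: simple normal crossings restrict to the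
hypersurface.** If `C` has simple normal crossings with the boundary `H :: E` on `X` — i.e. the
hypersurface `S = V(H)`, the divisors of `E` and the centre `C` are simultaneously given by
members of one regular system of parameters at each point ("`S` has only simple normal
crossings with `E`", and `C` snc with `E`) — and `H` is not itself a member of `E`, then the
restricted centre `C|_S` has simple normal crossings with the restricted boundary `E|_S` on `S`
(the parameters other than the equation of `S` restrict to a regular system of parameters of
`𝒪_{S,x} = 𝒪_{X,x}/(u)`). [cite: BierstoneGrigorievMilmanWlodarczyk2011, Lemma 3.9.4 (1)] -/
theorem HasSNCWith.comap_subschemeι_of_cons (h : HasSNCWith (H :: E) C) (hHE : H ∉ E) :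
    HasSNCWith (E.map fun D => D.comap H.subschemeι) (C.comap H.subschemeι) := by
  classical
  intro s
  have hxH := subschemeι_apply_mem_support H s
  obtain ⟨hreg, u, hu, ⟨ιX, hιX, hD⟩, hC⟩ := h (H.subschemeι s)
  haveI := hreg
  generalize hd : (maximalIdeal (X.presheaf.stalk (H.subschemeι s))).spanFinrank = d at u ιX hu hιX hD hC
  -- the member of the boundary `H` itself and its index
  obtain ⟨DH, hDH⟩ : ∃ DH : {D // D ∈ H :: E ∧ H.subschemeι s ∈ D.support}, DH.1 = H :=
    ⟨⟨H, List.mem_cons_self, hxH⟩, rfl⟩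
  obtain ⟨n, rfl⟩ : ∃ n, d = n + 1 := ⟨d - 1, (Nat.succ_pred_eq_of_pos (Fin.pos (ιX DH))).symm⟩
  -- the stalk map `q : 𝒪_{X,x} → 𝒪_{S,s}`, surjective with kernel `H_x = (u (ιX DH))`
  obtain ⟨q, hq_def⟩ : ∃ q : X.presheaf.stalk (H.subschemeι s) →+* H.subscheme.presheaf.stalk s,
      q = (H.subschemeι.stalkMap s).hom := ⟨_, rfl⟩
  have hq : Function.Surjective q := hq_def ▸ H.subschemeι.stalkMap_surjective s
  have hker : RingHom.ker q = Ideal.span {u (ιX DH)} := by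
    rw [hq_def, ker_stalkMap_subschemeι]
    have := hD DH
    rw [hDH] at this
    exact this
  have hq0 : q (u (ιX DH)) = 0 := by
    rw [← RingHom.mem_ker, hker]
    exact Ideal.mem_span_singleton_self _
  obtain ⟨hreg', hfr, hspan⟩ := rsop_quotient_succAbove q hq hd u hu (ιX DH) hker
  refine ⟨hreg', fun j => q (u ((ιX DH).succAbove (Fin.cast hfr j))), ?_, ?_, ?_⟩
  · -- the images generate `𝔪_{S,s}`
    have hrange : Set.range (fun j => q (u ((ιX DH).succAbove (Fin.cast hfr j)))) =
        Set.range (q ∘ u ∘ (ιX DH).succAbove) := by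
      ext a
      constructor
      · rintro ⟨j, rfl⟩
        exact ⟨Fin.cast hfr j, rfl⟩
      · rintro ⟨j, rfl⟩
        exact ⟨Fin.cast hfr.symm j, by simp⟩
    exact (congrArg Ideal.span hrange).trans hspan
  · -- the divisors of `E|_S` through `s`
    have hpre : ∀ D' : {D' // D' ∈ E.map (fun D => D.comap H.subschemeι) ∧ s ∈ D'.support},
        ∃ D : {D // D ∈ H :: E ∧ H.subschemeι s ∈ D.support},
          D.1 ∈ E ∧ D.1.comap H.subschemeι = D'.1 := by
      intro D'
      obtain ⟨D, hDE, hDeq⟩ := List.mem_map.mp D'.2.1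
      have hx : H.subschemeι s ∈ D.support := by
        have := D'.2.2
        rw [← hDeq, Scheme.IdealSheafData.support_comap] at this
        exact this
      exact ⟨⟨D, List.mem_cons_of_mem _ hDE, hx⟩, hDE, hDeq⟩
    choose pre hpreE hpre using hpre
    have hne : ∀ D', ιX (pre D') ≠ ιX DH := by
      intro D' heq
      have h1 := congrArg Subtype.val (hιX heq)
      rw [hDH] at h1
      exact hHE (h1 ▸ hpreE D')
    choose jj hjj using fun D' => Fin.exists_succAbove_eq (hne D')
    refine ⟨fun D' => Fin.cast hfr.symm (jj D'), ?_, ?_⟩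
    · intro D₁ D₂ heq
      have h1 : jj D₁ = jj D₂ := Fin.cast_injective _ heq
      have h2 : ιX (pre D₁) = ιX (pre D₂) := by rw [← hjj D₁, ← hjj D₂, h1]
      have h3 := congrArg Subtype.val (hιX h2)
      exact Subtype.ext (by rw [← hpre D₁, ← hpre D₂, h3])
    · intro D'
      rw [← hpre D', stalkIdeal_comap_eq_map_stalkMap, ← hq_def, hD (pre D'), Ideal.map_span,
        Set.image_singleton, ← hjj D']
      simp
  · -- the centre
    intro hs
    have hx : H.subschemeι s ∈ C.support := by
      rw [Scheme.IdealSheafData.support_comap] at hs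
      exact hs
    obtain ⟨T, hT⟩ := hC hx
    refine ⟨{j | (ιX DH).succAbove (Fin.cast hfr j) ∈ T}, ?_⟩
    rw [stalkIdeal_comap_eq_map_stalkMap, ← hq_def, hT, Ideal.map_span]
    apply le_antisymm
    · rw [Ideal.span_le]
      rintro _ ⟨_, ⟨i, hiT, rfl⟩, rfl⟩
      by_cases hi : i = ιX DH
      · rw [hi, hq0]
        exact zero_mem _
      · obtain ⟨j, rfl⟩ := Fin.exists_succAbove_eq hi
        refine Ideal.subset_span ⟨Fin.cast hfr.symm j, ?_, ?_⟩
        · simpa using hiT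
        · simp
    · rw [Ideal.span_le]
      rintro _ ⟨j, hj, rfl⟩
      exact Ideal.subset_span ⟨u ((ιX DH).succAbove (Fin.cast hfr j)), ⟨_, hj, rfl⟩, rfl⟩

end SNC

/-! ## BGMW Lemma 3.9.4 (1): an admissible centre inside `S` restricts to an admissible centre on `S` -/

section Admissible

variable {X : Scheme.{u}} {H C : X.IdealSheafData}

/-- Forgetting the first boundary divisor preserves simple normal crossings. [folklore] -/
theorem HasSNCWith.of_cons {D : X.IdealSheafData} {E : List X.IdealSheafData}
    (h : HasSNCWith (D :: E) C) : HasSNCWith E C := by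
  intro x
  obtain ⟨hreg, u, hu, ⟨ι, hι, hιD⟩, hC⟩ := h x
  refine ⟨hreg, u, hu, ⟨fun D' => ι ⟨D'.1, List.mem_cons_of_mem _ D'.2.1, D'.2.2⟩,
    fun D₁ D₂ heq => ?_, fun D' => hιD ⟨D'.1, List.mem_cons_of_mem _ D'.2.1, D'.2.2⟩⟩, hC⟩
  have := congrArg Subtype.val (hι heq)
  exact Subtype.ext this

/-- **BGMW Lemma 3.9.4 (1), one blow-up: the centre restricted to `S` is admissible for the
restricted marked ideal.** Let `(X, 𝓘, E, μ)` be a marked ideal, `S = V(H)` a hypersurface which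
together with `E` and the centre `C` is in simple normal crossings position (`C` snc with
`H :: E`, `H ∉ E`: "`S` has only simple normal crossings with `E`"), `C` admissible
(`V(C) ⊆ supp(𝓘, μ)`, `V(C)` regular) with `V(C) ⊆ S` (`H ⊆ C`), and `𝒩` a marked ideal on `S`
with boundary `E|_S` and `supp 𝒩 = ι⁻¹ supp(𝓘, μ)` (e.g. `𝒩 = 𝒞(𝓘, μ)|_S`, Lemma 3.9.4 first
claim, `CoefficientIdealRestriction.lean`; or a transform of it, clause (2),
`CoefficientIdealRestrictionPersistence.lean`). Then `C|_S` is an admissible centre for `𝒩`: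
`V(C|_S) ⊆ supp 𝒩`, `C|_S` has simple normal crossings with `E|_S`, and `V(C|_S) (≅ V(C))` is
regular — so that "the restrictions `σ_{i|S_i}` define a multiple blow-up `(S_i)` of
`𝒞(𝓘, μ)|_S`" (the blow-up of `S` along `C|_S` being the strict transform of `S`, §4 Remark (3),
`HypersurfaceRestriction.lean`). [cite: BierstoneGrigorievMilmanWlodarczyk2011, Lemma 3.9.4 (1)] -/
theorem MarkedIdeal.admissible_comap_subschemeι (M : MarkedIdeal X)
    (hsupp : (C.support : Set X) ⊆ M.support) (hsnc : HasSNCWith (H :: M.boundary) C)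
    (hHE : H ∉ M.boundary) (hC : Scheme.IsRegular C.subscheme) (hHC : H ≤ C)
    (N : MarkedIdeal H.subscheme) (hNs : N.support = H.subschemeι ⁻¹' M.support)
    (hNb : N.boundary = M.boundary.map fun D => D.comap H.subschemeι) :
    ((C.comap H.subschemeι).support : Set H.subscheme) ⊆ N.support ∧
      HasSNCWith N.boundary (C.comap H.subschemeι) ∧
      Scheme.IsRegular (C.comap H.subschemeι).subscheme := by
  refine ⟨fun s hs => ?_, hNb ▸ hsnc.comap_subschemeι_of_cons hHE,
    (isRegular_subscheme_comap_subschemeι_iff H hHC).mpr hC⟩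
  rw [hNs, Set.mem_preimage]
  apply hsupp
  rw [SetLike.mem_coe, Scheme.IdealSheafData.support_comap] at hs
  exact hs

/-- Hence **the restriction of an admissible blow-up is an admissible blow-up of
`𝒞(𝓘, μ)|_S`** (BGMW Lemma 3.9.4 (1) for one blow-up, with the restriction property §4
Remark (3)): with hypotheses as in `MarkedIdeal.admissible_comap_subschemeι` on a locally
Noetherian regular `X` with `H` generated at the points of `S` by elements of order one, a
blow-up `π : X' → X` along `C` and the induced `πS : S' = V(σᶜ(H, 1)) → S`, the transform of `𝒩`
along `πS` with centre `C|_S` is a multiple blow-up of `𝒩` in the sense of Def. 3.1.3–3.1.4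
(`IsMultipleBlowup`). [cite: BierstoneGrigorievMilmanWlodarczyk2011, Lemma 3.9.4 (1)] -/
theorem IsBlowup.isMultipleBlowup_transform_comap_subschemeι [IsLocallyNoetherian X]
    {X' : Scheme.{u}} {π : X' ⟶ X} (hX : Scheme.IsRegular X) (hπ : IsBlowup π C)
    (hH : ∀ x ∈ H.support, ∃ v : X.presheaf.stalk x,
      stalkIdeal H x = Ideal.span {v} ∧ v ∉ (maximalIdeal (X.presheaf.stalk x)) ^ 2)
    (πS : (controlledTransform π C H 1).subscheme ⟶ H.subscheme)
    (hπS : πS ≫ H.subschemeι = (controlledTransform π C H 1).subschemeι ≫ π)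
    (M : MarkedIdeal X) (hsupp : (C.support : Set X) ⊆ M.support)
    (hsnc : HasSNCWith (H :: M.boundary) C) (hHE : H ∉ M.boundary)
    (hC : Scheme.IsRegular C.subscheme) (hHC : H ≤ C)
    (N : MarkedIdeal H.subscheme) (hNs : N.support = H.subschemeι ⁻¹' M.support)
    (hNb : N.boundary = M.boundary.map fun D => D.comap H.subschemeι) :
    IsMultipleBlowup N πS (N.transform πS (C.comap H.subschemeι)) := by
  obtain ⟨h1, h2, h3⟩ := M.admissible_comap_subschemeι hsupp hsnc hHE hC hHC N hNs hNb
  exact IsMultipleBlowup.single N _ πS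
    (hπ.isBlowup_subscheme_controlledTransform hX hC hHC hH πS hπS) h3 h1 h2

end Admissible

end Literature.AlgebraicGeometry.Resolution

end
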